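import Literature.AlgebraicGeometry.HodgeTheory.MaxRationalSubHodgeStructureHodgeNumberBound
import HarnessLib

/-!
# `GHC(X, k, r)` in Gysin form: every admissible subspace of `(Hᵏ, Fʳ)` lies in the span of the Gysin images
# `g_* Hᵃ(Y(ℂ); ℂ)`, `g : Y ⟶ X` smooth projective with `dim Y + r ≤ dim X` — and in ONE finite such family
# (Voisin 2025, Conj. 4.6, second form; Grothendieck 1969, §1)

Family `hodge`, layer `Literature/AlgebraicGeometry/HodgeTheory`; lane `lit-hodgefound` (Track 2 foundations,
Layer A1/A4). THEOREMS ONLY (no definition, no named fact; D-0026).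

Voisin (J. Open Math. Probl. 1 (2025), Conjecture 4.6 [Gro69], PDF p. 26): «Let `X` be a smooth complex
projective variety, and let `L ⊂ Hᵏ(X, ℚ)` be a Hodge substructure of coniveau `c`. Then `L` is of geometric
coniveau `≥ c`, that is, there exists a closed algebraic subset `Z ⊂ X` of codimension `≥ c` such that
`L ⊂ Ker(Hᵏ(X, ℚ) → Hᵏ(X ∖ Z, ℚ))`. Equivalently (by Corollary 4.5(ii)), there exist a smooth projective variety
`Y` of dimension `n − c` and a morphism `j : Y → X`, such that `L ⊂ Im ( j_* : H^{k−2c}(Y, ℚ) → Hᵏ(X, ℚ))`.»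

The tree proves Grothendieck's two descriptions of the coniveau classes agree UNCONDITIONALLY
(`supportedClasses_eq_iSup_range_complexGysin`: `Nʳ Hᵏ(X(ℂ); ℂ)` = the span of the Gysin images
`g_* Hᵃ(Y(ℂ); ℂ)`, `g : Y ⟶ X`, `Y` smooth projective, `dim Y + r ≤ n`, `a + 2n = k + 2 dim Y`; Deligne's
Cor. 8.2.8 and Hironaka, both theorems of the tree), with a finite-family refinement
(`exists_finite_family_of_span_le_supportedClasses`). Read through Grothendieck's amended conjecture
`GeneralHodgePropertyFor n X k r` (every admissible subspace of `(Hᵏ, Fʳ)` — rationally spanned, sub-Hodge,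
inside `Fʳ`; `HodgeModel.ratSubHodgeInFilt` — lies in `Nʳ Hᵏ`; `HodgeModel.maxRatSubHodgeInFilt` the largest
one) this gives:

* §1 **`le_supportedClasses_iff_le_iSup_range_complexGysin`** and **`le_supportedClasses_iff_exists_finite_family`**
  — a subspace `W ≤ Hᵏ(X(ℂ); ℂ)` lies in `Nʳ Hᵏ` iff it lies in the Gysin span iff ONE FINITE family
  `gⱼ : Yⱼ ⟶ X` of smooth projective `Yⱼ` with `dim Yⱼ + r ≤ n` carries it, `W ≤ Σⱼ im (gⱼ)_*`
  (`Hᵏ` is finite-dimensional, so `W` is finitely generated).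
* §2 **`generalHodgePropertyFor_iff_forall_le_iSup_range_complexGysin`** (`GHC(X, k, r)` ⟺ every admissible `W`
  lies in the Gysin span), **`generalHodgePropertyFor_iff_maxRatSubHodgeInFilt_le_iSup_range_complexGysin`**
  (⟺ `max(k, r)` does), **`generalHodgePropertyFor_iff_forall_exists_finite_family`** (⟺ every admissible `W`
  is carried by one finite Gysin family — Voisin's second form, with a finite family of `Y`'s of dimensions
  `≤ n − r` in place of one `Y` of dimension `n − r`) and
  **`generalHodgePropertyFor_iff_exists_finite_family_maxRatSubHodgeInFilt`** (⟺ ONE finite family carries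
  `max(k, r)`, hence every admissible subspace at once).
* §3 The MODEL-FREE printed form **`generalHodgePropertyFor_iff_gysin_level`**: `GHC(X, k, r)` iff every
  rationally spanned Hodge subspace `W ⊆ Hᵏ(X(ℂ); ℂ)` (`IsHodgeSubspace`) of Hodge coniveau `≥ r` is carried by
  a finite Gysin family from smooth projective varieties of dimension `≤ n − r` (the tree's level form
  `generalHodgePropertyFor_iff_forall_isHodgeSubspace`, Murre §5.7 b, composed with §1).

All statements hold for every orientation family `μ` (the Gysin morphisms `complexGysin μ` depend on it; the
coniveau classes do not).

## References

* [Voisin2025] C. Voisin, Hodge and generalized Hodge conjectures, coniveau and algebraic cycles, J. Open Math.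
  Probl. 1 (2025), §4.1 Cor. 4.5 (ii), §4.2 Conj. 4.6, §4.3 (32).
* [GrothendieckTopology1969] A. Grothendieck, Hodge's general conjecture is false for trivial reasons, Topology 8
  (1969), §1 and p. 300.
* [DeligneHodgeIII1974] P. Deligne, Théorie de Hodge III, Cor. 8.2.8.
* [MurreTorino1994] J. P. Murre, Algebraic cycles and algebraic aspects of cohomology and K-theory, LNM 1594
  (1994), §5.6–§5.7 b.
-/

noncomputable section

open CategoryTheory AlgebraicGeometry Module
open Literature.AlgebraicTopology.SingularHomology
open Literature.Geometry.Kaehler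
open Literature.AlgebraicGeometry.Motives (IsSmoothProjective ComplexPoints)

namespace Literature.AlgebraicGeometry.HodgeTheory

variable {n : ℕ} {X : Motives.SchemeOver ℂ}

/-! ### §1 A subspace lies in `Nʳ Hᵏ` iff it lies in the Gysin span iff one finite Gysin family carries it -/

/-- **`W ≤ Nʳ Hᵏ(X(ℂ); ℂ)` iff `W` lies in the span of the Gysin images `g_* Hᵃ(Y(ℂ); ℂ)`** over the morphisms
`g : Y ⟶ X` from smooth projective `Y` with `dim Y + r ≤ dim X` (the tree's
`supportedClasses_eq_iSup_range_complexGysin`, unconditional). [cite: GrothendieckTopology1969, §1 and p. 300]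
[cite: Voisin2025, §4.1 Cor. 4.5 (ii)] -/
theorem le_supportedClasses_iff_le_iSup_range_complexGysin (μ : OrientationFamily)
    (hX : IsSmoothProjective n X) {k r : ℕ} (W : Submodule ℂ (complexBetti X k)) :
    W ≤ supportedClasses X k r ↔
      W ≤ ⨆ (m : ℕ) (_ : m + r ≤ n) (Y : Motives.SchemeOver ℂ) (hY : IsSmoothProjective m Y)
        (g : Y ⟶ X) (a : ℕ) (hab : a + 2 * n = k + 2 * m), LinearMap.range (complexGysin μ hY hX g hab) := by
  rw [supportedClasses_eq_iSup_range_complexGysin μ hX k r]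

/-- **`W ≤ Nʳ Hᵏ(X(ℂ); ℂ)` iff ONE FINITE family of Gysin images carries `W`**: there are finitely many
morphisms `gⱼ : Yⱼ ⟶ X` from smooth projective `Yⱼ` with `dim Yⱼ + r ≤ dim X` and
`W ≤ Σⱼ Σₐ im((gⱼ)_* : Hᵃ(Yⱼ(ℂ); ℂ) → Hᵏ(X(ℂ); ℂ))` (`Hᵏ(X(ℂ); ℂ)` is finite-dimensional, so `W` is spanned by a
finite set, to which the tree's `exists_finite_family_of_span_le_supportedClasses` applies; conversely every
Gysin image from `dim Y + r ≤ n` lies in `Nʳ`, `iSup_range_complexGysin_le_supportedClasses`).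
[cite: Voisin2025, §4.2 Conj. 4.6 (second form) and §4.3 (32)] [cite: DeligneHodgeIII1974, Cor. 8.2.8]
[cite: GrothendieckTopology1969, p. 300] -/
theorem le_supportedClasses_iff_exists_finite_family (μ : OrientationFamily) (hX : IsSmoothProjective n X)
    {k r : ℕ} (W : Submodule ℂ (complexBetti X k)) :
    W ≤ supportedClasses X k r ↔
      ∃ (ι : Type) (_ : Finite ι) (m : ι → ℕ) (Y : ι → Motives.SchemeOver ℂ)
        (hY : ∀ j, IsSmoothProjective (m j) (Y j)) (g : ∀ j, Y j ⟶ X), (∀ j, m j + r ≤ n) ∧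
          W ≤ ⨆ (j : ι) (a : ℕ) (hab : a + 2 * n = k + 2 * m j),
            LinearMap.range (complexGysin μ (hY j) hX (g j) hab) := by
  classical
  refine ⟨fun h ↦ ?_, ?_⟩
  · haveI := finite_complexBetti hX k
    obtain ⟨s, hs⟩ : W.FG := IsNoetherian.noetherian W
    obtain ⟨ι, hι, m, Y, hY, g, hm, hle⟩ := exists_finite_family_of_span_le_supportedClasses μ hX s
      fun x hx ↦ h (hs ▸ Submodule.subset_span hx)
    refine ⟨ι, hι, m, Y, hY, g, hm, ?_⟩
    rw [← hs]
    exact hle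
  · rintro ⟨ι, _, m, Y, hY, g, hm, hle⟩
    refine hle.trans ((iSup_le fun j ↦ iSup_le fun a ↦ iSup_le fun hab ↦ ?_).trans
      (iSup_range_complexGysin_le_supportedClasses μ hX k r))
    exact le_iSup_of_le (m j) (le_iSup_of_le (hm j) (le_iSup_of_le (Y j) (le_iSup_of_le (hY j)
      (le_iSup_of_le (g j) (le_iSup_of_le a (le_iSup_of_le hab le_rfl))))))

/-! ### §2 `GHC(X, k, r)` in Gysin form -/

/-- **`GHC(X, k, r)` iff every admissible subspace of `(Hᵏ, Fʳ)` lies in the span of the Gysin images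
`g_* Hᵃ(Y(ℂ); ℂ)`, `g : Y ⟶ X` smooth projective with `dim Y + r ≤ dim X`.** [cite: Voisin2025, §4.2 Conj. 4.6]
[cite: GrothendieckTopology1969, p. 300] -/
theorem generalHodgePropertyFor_iff_forall_le_iSup_range_complexGysin (μ : OrientationFamily)
    (A : HodgeModel n X) (hX : IsSmoothProjective n X) (k r : ℕ) :
    GeneralHodgePropertyFor n X k r ↔ ∀ W ∈ A.ratSubHodgeInFilt k r,
      W ≤ ⨆ (m : ℕ) (_ : m + r ≤ n) (Y : Motives.SchemeOver ℂ) (hY : IsSmoothProjective m Y)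
        (g : Y ⟶ X) (a : ℕ) (hab : a + 2 * n = k + 2 * m), LinearMap.range (complexGysin μ hY hX g hab) := by
  rw [generalHodgePropertyFor_iff_of_hodgeModel A hX k r, HodgeModel.maxRatSubHodgeInFilt, sSup_le_iff]
  exact forall₂_congr fun W _ ↦ le_supportedClasses_iff_le_iSup_range_complexGysin μ hX W

/-- **`GHC(X, k, r)` iff `max(k, r)` lies in the Gysin span from `dim Y + r ≤ dim X`.** [cite: Voisin2025, §4.2 Conj. 4.6]
[cite: GrothendieckTopology1969, p. 300] [cite: MurreTorino1994, §5.6] -/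
theorem generalHodgePropertyFor_iff_maxRatSubHodgeInFilt_le_iSup_range_complexGysin (μ : OrientationFamily)
    (A : HodgeModel n X) (hX : IsSmoothProjective n X) (k r : ℕ) :
    GeneralHodgePropertyFor n X k r ↔
      A.maxRatSubHodgeInFilt k r ≤ ⨆ (m : ℕ) (_ : m + r ≤ n) (Y : Motives.SchemeOver ℂ)
        (hY : IsSmoothProjective m Y) (g : Y ⟶ X) (a : ℕ) (hab : a + 2 * n = k + 2 * m),
          LinearMap.range (complexGysin μ hY hX g hab) := by
  rw [generalHodgePropertyFor_iff_of_hodgeModel A hX k r,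
    le_supportedClasses_iff_le_iSup_range_complexGysin μ hX]

/-- **VOISIN'S SECOND FORM OF `GHC` ON THE CARRIERS: `GHC(X, k, r)` iff every admissible subspace `W` of
`(Hᵏ, Fʳ)` is carried by ONE FINITE family of Gysin images** `(gⱼ)_* Hᵃ(Yⱼ(ℂ); ℂ)`, `gⱼ : Yⱼ ⟶ X` smooth
projective with `dim Yⱼ + r ≤ dim X` («there exist a smooth projective variety `Y` of dimension `n − c` and a
morphism `j : Y → X`, such that `L ⊂ Im (j_* : H^{k−2c}(Y, ℚ) → Hᵏ(X, ℚ))`»; here a finite family with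
`dim Yⱼ ≤ n − c`). [cite: Voisin2025, §4.2 Conj. 4.6 (second form)] [cite: GrothendieckTopology1969, p. 300] -/
theorem generalHodgePropertyFor_iff_forall_exists_finite_family (μ : OrientationFamily) (A : HodgeModel n X)
    (hX : IsSmoothProjective n X) (k r : ℕ) :
    GeneralHodgePropertyFor n X k r ↔ ∀ W ∈ A.ratSubHodgeInFilt k r,
      ∃ (ι : Type) (_ : Finite ι) (m : ι → ℕ) (Y : ι → Motives.SchemeOver ℂ)
        (hY : ∀ j, IsSmoothProjective (m j) (Y j)) (g : ∀ j, Y j ⟶ X), (∀ j, m j + r ≤ n) ∧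
          W ≤ ⨆ (j : ι) (a : ℕ) (hab : a + 2 * n = k + 2 * m j),
            LinearMap.range (complexGysin μ (hY j) hX (g j) hab) := by
  rw [generalHodgePropertyFor_iff_of_hodgeModel A hX k r, HodgeModel.maxRatSubHodgeInFilt, sSup_le_iff]
  exact forall₂_congr fun W _ ↦ le_supportedClasses_iff_exists_finite_family μ hX W

/-- **`GHC(X, k, r)` iff ONE FINITE Gysin family carries `max(k, r)`** (hence every admissible subspace of
`(Hᵏ, Fʳ)` at once). [cite: Voisin2025, §4.2 Conj. 4.6 and §4.3 (32)] [cite: GrothendieckTopology1969, p. 300] -/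
theorem generalHodgePropertyFor_iff_exists_finite_family_maxRatSubHodgeInFilt (μ : OrientationFamily)
    (A : HodgeModel n X) (hX : IsSmoothProjective n X) (k r : ℕ) :
    GeneralHodgePropertyFor n X k r ↔
      ∃ (ι : Type) (_ : Finite ι) (m : ι → ℕ) (Y : ι → Motives.SchemeOver ℂ)
        (hY : ∀ j, IsSmoothProjective (m j) (Y j)) (g : ∀ j, Y j ⟶ X), (∀ j, m j + r ≤ n) ∧
          A.maxRatSubHodgeInFilt k r ≤ ⨆ (j : ι) (a : ℕ) (hab : a + 2 * n = k + 2 * m j),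
            LinearMap.range (complexGysin μ (hY j) hX (g j) hab) := by
  rw [generalHodgePropertyFor_iff_of_hodgeModel A hX k r, le_supportedClasses_iff_exists_finite_family μ hX]

/-! ### §3 The model-free printed form: Hodge subspaces of Hodge coniveau `≥ r` are carried by Gysin families -/

/-- **`GHC(X, k, r)` ⟺ every rationally spanned Hodge subspace `W ⊆ Hᵏ(X(ℂ); ℂ)` of Hodge coniveau `≥ r`
is carried by a finite family of Gysin images from smooth projective varieties of dimension `≤ dim X − r`**
(Voisin's Conjecture 4.6 in its second form, the sub-Hodge condition read model-free as `IsHodgeSubspace` and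
the Hodge coniveau in one Hodge model `A`; the tree's level form `generalHodgePropertyFor_iff_forall_isHodgeSubspace`
composed with §1). [cite: Voisin2025, §4.2 Conj. 4.6] [cite: MurreTorino1994, §5.7 b]
[cite: GrothendieckTopology1969, p. 300] -/
theorem generalHodgePropertyFor_iff_gysin_level (μ : OrientationFamily) (hX : IsSmoothProjective n X)
    (A : HodgeModel n X) (k r : ℕ) :
    GeneralHodgePropertyFor n X k r ↔
      ∀ W : Submodule ℂ (complexBetti X k), IsRationallySpanned W → IsHodgeSubspace n X k W →
        W.map (A.pullback k).hom ≤ A.hodgeConiveau k r →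
          ∃ (ι : Type) (_ : Finite ι) (m : ι → ℕ) (Y : ι → Motives.SchemeOver ℂ)
            (hY : ∀ j, IsSmoothProjective (m j) (Y j)) (g : ∀ j, Y j ⟶ X), (∀ j, m j + r ≤ n) ∧
              W ≤ ⨆ (j : ι) (a : ℕ) (hab : a + 2 * n = k + 2 * m j),
                LinearMap.range (complexGysin μ (hY j) hX (g j) hab) := by
  rw [generalHodgePropertyFor_iff_forall_isHodgeSubspace hX A]
  refine forall_congr' fun W ↦ forall_congr' fun _ ↦ forall_congr' fun _ ↦ forall_congr' fun _ ↦ ?_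
  rw [le_supportedClasses_iff_exists_finite_family μ hX W]

end Literature.AlgebraicGeometry.HodgeTheory

end
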